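import Literature.Analysis.FluidPDE.RenormalizedDiffusivityCascadeProofs
import HarnessLib

/-!
# Armstrong–Vicol's cascade of renormalised diffusivities, Lemma 3.4 — Step 2 (stability)

S. Armstrong, V. Vicol, *Anomalous diffusion by fractal homogenization*, Ann. PDE **11** (2025)
= arXiv:2305.05048v3, §3.3, Lemma 3.4 p. 43, proof, Step 2 pp. 44–45 ((3.55)–(3.59)), with the
one-step homogenisation estimate Lemma 3.3 (3.39) p. 42 as input. [`ArmstrongVicol2025`]

Step 1 (`modelDiffusivity_bounds`, companion file `RenormalizedDiffusivityCascadeProofs.lean`)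
controls the MODEL cascade (3.47) `κ'ₘ₋₁ = κ'ₘ + 9aₘ²εₘ⁴/(80κ'ₘ)`. The actual renormalised
diffusivities `κₘ₋₁ = K̄ₘ^{κₘ}` ((3.42)) obey this recursion only approximately: by Lemma 3.3
((3.39) p. 42), `|K̄ₘ^κ - (κ + 9aₘ²εₘ⁴/(80κ))| ≤ (aₘ²εₘ⁴/κ)(C εₘ²/(κτₘ) + C εₘ₋₁^δ)`, and along
the inductive range (3.56) (`½ ≤ κ'ₘ/κₘ ≤ 2`) the right side is a factor `C εₘ₋₁^{2δ}` of the step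
((3.55), (3.57)): `(1 - Cεₙ₋₁^{2δ})(1 + 9aₙ²εₙ⁴/(80κₙ²)) ≤ κₙ₋₁/κₙ ≤ (1 + Cεₙ₋₁^{2δ})(…)`. Step 2
then shows `max{κₘ/κ'ₘ, κ'ₘ/κₘ} ≤ ∏ⱼ (1 + C εⱼ₋₁^{2(δ∧γ)}) ≤ C` ((3.58)–(3.59)).

## What is here (all PROVED; no named facts)

The construction-specific input (Lemma 3.3, the time scales `τₘ` of (2.12)) is replaced by its
printed consequence (3.57) taken as an hypothesis ON THE INDUCTIVE RANGE (3.56) — this is the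
abstract "general form" of Step 2 announced as a TODO in `RenormalizedDiffusivityCascade.lean`:

* `enhanceStep_ratio_le`: the model step `E(κ) = κ + D/κ` does not expand ratios,
  `max{E x/E y, E y/E x} ≤ max{x/y, y/x}` (the "exact recursion formula" step between (3.57)
  and (3.58));
* `cascade_bound_of_le`: the telescoping bookkeeping of (3.58) with a step inequality that is
  only available while the running bound stays below a barrier `B` (the bootstrap (3.56));
* `perturbedDiffusivity_close` (**Step 2, (3.56)–(3.59) p. 45**): there is `η > 0` depending only
  on the relative-error constant `C₀` and exponent `σ` such that, for every scale sequence with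
  `ε₁ ≤ η` (i.e. minimal scale separation `Λ` large — the paper's "for some `n₀(data)`" made
  quantitative), every positive sequence `κₘ` with `κ_M = κ'_M` whose steps satisfy the printed
  relative estimate (3.57) `|κₙ₋₁ - E(κₙ)| ≤ C₀ εₙ₋₁^σ E(κₙ)` whenever `½κ'ₙ ≤ κₙ ≤ 2κ'ₙ`, stays
  within a factor `2` of the model cascade: `½ κ'ₘ ≤ κₘ ≤ 2 κ'ₘ` for all `1 ≤ m ≤ M`;
* `perturbedDiffusivity_bounds`: combined with Step 1, the two-sided bound (3.45)
  `c aₘ εₘ^{2+γ} ≤ κₘ ≤ C aₘ εₘ^{2+γ}`, `1 ≤ m ≤ M-1`, for every such perturbed cascade started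
  in the permissible window (3.44), constants depending only on `β`, `q`.

Not here: the verification that `K̄ₘ^{κₘ}` satisfies the hypothesis (Lemma 3.3 + (3.55), internal
to the construction), and (3.46).

## References

* S. Armstrong, V. Vicol, *Anomalous diffusion by fractal homogenization*, Ann. PDE 11 (2025),
  no. 1, Paper No. 2 (doi:10.1007/s40818-024-00189-6; arXiv:2305.05048v3), Lemma 3.3 (3.39)
  p. 42, Lemma 3.4 p. 43, proof Step 2 (3.55)–(3.59) pp. 44–45. [`ArmstrongVicol2025`]
-/

open Real

namespace Literature.Analysis.FluidPDE

namespace ArmstrongVicol2025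

/-- The model step does not expand ratios: for `E(κ) = κ + 9a²ε⁴/(80κ)` and `x, y > 0`,
`max{E x / E y, E y / E x} ≤ max{x/y, y/x}` (`E x / E y` is a convex combination of `x/y` and
`y/x`). This is the "exact recursion formula for `κ'ₙ₋₁`" step from (3.57) to (3.58).
[cite: ArmstrongVicol2025, Lemma 3.4, proof Step 2, (3.57)–(3.58) p. 45] -/
theorem enhanceStep_ratio_le {a e x y : ℝ} (hx : 0 < x) (hy : 0 < y) :
    max (enhanceStep a e x / enhanceStep a e y) (enhanceStep a e y / enhanceStep a e x) ≤
      max (x / y) (y / x) := by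
  set D := 9 * a ^ 2 * e ^ 4 / 80 with hD
  have hD0 : 0 ≤ D := by positivity
  have hEx : enhanceStep a e x = x + D / x := by unfold enhanceStep; rw [hD]; field_simp
  have hEy : enhanceStep a e y = y + D / y := by unfold enhanceStep; rw [hD]; field_simp
  have hExpos : 0 < enhanceStep a e x := enhanceStep_pos hx
  have hEypos : 0 < enhanceStep a e y := enhanceStep_pos hy
  set L := max (x / y) (y / x) with hL
  have h1 : x / y ≤ L := le_max_left _ _
  have h2 : y / x ≤ L := le_max_right _ _
  have hL0 : 0 ≤ L := (div_pos hx hy).le.trans h1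
  -- `E x ≤ L · E y` and `E y ≤ L · E x`
  have hA : enhanceStep a e x ≤ L * enhanceStep a e y := by
    rw [hEx, hEy, mul_add]
    apply add_le_add
    · calc x = x / y * y := by field_simp
        _ ≤ L * y := mul_le_mul_of_nonneg_right h1 hy.le
    · calc D / x = y / x * (D / y) := by field_simp
        _ ≤ L * (D / y) := mul_le_mul_of_nonneg_right h2 (by positivity)
  have hB : enhanceStep a e y ≤ L * enhanceStep a e x := by
    rw [hEx, hEy, mul_add]
    apply add_le_add
    · calc y = y / x * x := by field_simp
        _ ≤ L * x := mul_le_mul_of_nonneg_right h2 hx.le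
    · calc D / y = x / y * (D / x) := by field_simp
        _ ≤ L * (D / x) := mul_le_mul_of_nonneg_right h1 (by positivity)
  exact max_le ((div_le_iff₀ hEypos).mpr hA) ((div_le_iff₀ hExpos).mpr hB)

/-- The bookkeeping (3.58) under the bootstrap (3.56): if `Lₘ ≤ exp(K eₘ) Lₘ₊₁` holds for
`1 ≤ m < N` AS LONG AS `Lₘ₊₁ ≤ B`, the weights contract (`eₘ₊₁ ≤ ρ eₘ`, `ρ < 1`) and the would-be
final bound `L_N exp(K e₁/(1-ρ))` is at most `B`, then `Lₘ ≤ L_N exp(K eₘ/(1-ρ))` for all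
`1 ≤ m ≤ N`. [cite: ArmstrongVicol2025, Lemma 3.4, proof Step 2, (3.56)–(3.58) p. 45] -/
theorem cascade_bound_of_le {L e : ℕ → ℝ} {K ρ B : ℝ} {N : ℕ} (hK : 0 ≤ K) (hρ1 : ρ < 1)
    (hL : ∀ m, 0 ≤ L m) (he : ∀ m, 0 ≤ e m) (hdec : ∀ m, e (m + 1) ≤ ρ * e m)
    (hB : L N * exp (K / (1 - ρ) * e 1) ≤ B)
    (hstep : ∀ m, 1 ≤ m → m + 1 ≤ N → L (m + 1) ≤ B → L m ≤ exp (K * e m) * L (m + 1)) :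
    ∀ m, 1 ≤ m → m ≤ N → L m ≤ L N * exp (K / (1 - ρ) * e m) := by
  set K' := K / (1 - ρ) with hK'
  have h1ρ : 0 < 1 - ρ := by linarith
  have hK'0 : 0 ≤ K' := div_nonneg hK h1ρ.le
  have hKK' : K + K' * ρ = K' := by
    rw [hK']; field_simp; ring
  -- the weights decrease: `e m ≤ e 1` for `m ≥ 1`
  have hsucc : ∀ m, e (m + 1) ≤ e m := fun m =>
    (hdec m).trans (by nlinarith [he m])
  have hmono : ∀ m, 1 ≤ m → e m ≤ e 1 := by
    intro m hm
    induction m with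
    | zero => omega
    | succ m ih =>
      rcases Nat.lt_or_ge m 1 with h | h
      · have : m = 0 := by omega
        subst this; exact le_rfl
      · exact (hsucc m).trans (ih h)
  have key : ∀ n m, m + n = N → 1 ≤ m → L m ≤ L N * exp (K' * e m) := by
    intro n
    induction n with
    | zero =>
      intro m hm _
      simp only [add_zero] at hm
      subst hm
      have : 1 ≤ exp (K' * e m) := le_trans (by nlinarith [he m]) (add_one_le_exp _)
      nlinarith [hL m]
    | succ n ih =>
      intro m hm h1
      have ih' := ih (m + 1) (by omega) (by omega)
      have hLB : L (m + 1) ≤ B := by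
        refine ih'.trans (le_trans ?_ hB)
        exact mul_le_mul_of_nonneg_left
          (exp_le_exp.mpr (mul_le_mul_of_nonneg_left (hmono (m + 1) (by omega)) hK'0)) (hL N)
      have hst := hstep m h1 (by omega) hLB
      calc L m ≤ exp (K * e m) * L (m + 1) := hst
        _ ≤ exp (K * e m) * (L N * exp (K' * e (m + 1))) :=
            mul_le_mul_of_nonneg_left ih' (exp_pos _).le
        _ = L N * exp (K * e m + K' * e (m + 1)) := by rw [exp_add]; ring
        _ ≤ L N * exp (K' * e m) := by
            apply mul_le_mul_of_nonneg_left _ (hL N)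
            apply exp_le_exp.mpr
            have h2 : K' * e (m + 1) ≤ K' * ρ * e m := by
              calc K' * e (m + 1) ≤ K' * (ρ * e m) := mul_le_mul_of_nonneg_left (hdec m) hK'0
                _ = K' * ρ * e m := by ring
            have h3 : K * e m + K' * ρ * e m = K' * e m := by linear_combination (e m) * hKK'
            linarith
  intro m h1 hmN
  obtain ⟨n, hn⟩ : ∃ n, m + n = N := ⟨N - m, by omega⟩
  exact key n m hn h1

/-- A relative step estimate `|k - E| ≤ θ E` with `θ ≤ ½` bounds both ratios:
`max{k/E, E/k} ≤ exp(2θ)`. [cite: ArmstrongVicol2025, Lemma 3.4, proof Step 2, (3.57) p. 45] -/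
theorem max_div_le_exp_of_abs_sub_le {k E θ : ℝ} (hE : 0 < E) (hθ0 : 0 ≤ θ) (hθ : θ ≤ 1 / 2)
    (h : |k - E| ≤ θ * E) : max (k / E) (E / k) ≤ exp (2 * θ) := by
  have hlo : (1 - θ) * E ≤ k := by have := (abs_le.mp h).1; linarith
  have hhi : k ≤ (1 + θ) * E := by have := (abs_le.mp h).2; linarith
  have hk : 0 < k := lt_of_lt_of_le (by nlinarith) hlo
  have h2θ := add_one_le_exp (2 * θ)
  refine max_le ?_ ?_
  · rw [div_le_iff₀ hE]; nlinarith
  · rw [div_le_iff₀ hk]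
    -- `E ≤ exp(2θ) k`: `E ≤ (1 + 2θ)(1 - θ) E ≤ (1 + 2θ) k` since `(1+2θ)(1-θ) = 1 + θ - 2θ² ≥ 1`
    have h1 : E ≤ (1 + 2 * θ) * ((1 - θ) * E) := by nlinarith
    have h2 : (1 + 2 * θ) * ((1 - θ) * E) ≤ (1 + 2 * θ) * k :=
      mul_le_mul_of_nonneg_left hlo (by linarith)
    nlinarith

/-- **Armstrong–Vicol, Lemma 3.4, Step 2 ((3.56)–(3.59) p. 45): stability of the cascade.** Let
`ε` be a scale sequence ((2.8)–(2.10)), `a` any amplitude sequence, `κ'ₘ` the model cascade (3.47)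
started from `κ₀ > 0` at the critical scale `M`, and `κₘ > 0` a sequence with `κ_M = κ₀` whose
steps obey the printed relative estimate (3.57) on the inductive range (3.56): whenever
`½ κ'ₙ₊₁ ≤ κₙ₊₁ ≤ 2 κ'ₙ₊₁`, `|κₙ - E(κₙ₊₁)| ≤ C₀ εₙ^σ E(κₙ₊₁)` with `E = enhanceStep aₙ₊₁ εₙ₊₁`
(for `K̄` this is Lemma 3.3 (3.39) with (3.55), `σ = 2δ`). Then, provided the minimal scale
separation is large (`ε₁ ≤ η`, `η > 0` depending only on `C₀`, `σ` — the paper's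
"for some `n₀(data)`"), `½ κ'ₘ ≤ κₘ ≤ 2 κ'ₘ` for every `1 ≤ m ≤ M` ((3.59)).
[cite: ArmstrongVicol2025, Lemma 3.4, proof Step 2, (3.56)–(3.59) p. 45] -/
theorem perturbedDiffusivity_close {q σ C₀ : ℝ} (hσ : 0 < σ) (hC₀ : 0 ≤ C₀) :
    ∃ η : ℝ, 0 < η ∧
      ∀ ε : ℕ → ℝ, IsScaleSequence q ε → ε 1 ≤ η →
      ∀ (a : ℕ → ℝ) (M : ℕ) (κ₀ : ℝ), 0 < κ₀ →
      ∀ κ : ℕ → ℝ, (∀ n, 0 < κ n) → κ M = κ₀ →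
        (∀ n, 1 ≤ n → n + 1 ≤ M →
          modelDiffusivity a ε M κ₀ (n + 1) / 2 ≤ κ (n + 1) →
          κ (n + 1) ≤ 2 * modelDiffusivity a ε M κ₀ (n + 1) →
          |κ n - enhanceStep (a (n + 1)) (ε (n + 1)) (κ (n + 1))| ≤
            C₀ * ε n ^ σ * enhanceStep (a (n + 1)) (ε (n + 1)) (κ (n + 1))) →
        ∀ m, 1 ≤ m → m ≤ M →
          modelDiffusivity a ε M κ₀ m / 2 ≤ κ m ∧ κ m ≤ 2 * modelDiffusivity a ε M κ₀ m := by
  -- constants: `K = 2C₀`, `ρ = 2^{-7σ}`, threshold `t` on `ε₁^σ`, `η = t^{1/σ}`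
  set K := 2 * C₀ with hK
  have hK0 : 0 ≤ K := by rw [hK]; linarith
  set ρ := (((2 : ℝ) ^ 7)⁻¹) ^ σ with hρ
  have hρ1 : ρ < 1 := rpow_lt_one (by positivity) (by norm_num) hσ
  have h1ρ : 0 < 1 - ρ := by linarith
  have hlog2 : 0 < log 2 := log_pos one_lt_two
  set t := min (1 / (2 * C₀ + 2)) ((1 - ρ) * log 2 / (K + 1)) with ht
  have htpos : 0 < t := lt_min (by positivity) (by positivity)
  have ht1 : t ≤ 1 / (2 * C₀ + 2) := min_le_left _ _
  have ht2 : t ≤ (1 - ρ) * log 2 / (K + 1) := min_le_right _ _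
  set η := t ^ (1 / σ) with hη
  have hηpos : 0 < η := rpow_pos_of_pos htpos _
  have hησ : η ^ σ = t := by
    rw [hη, ← rpow_mul htpos.le, one_div_mul_cancel hσ.ne', rpow_one]
  refine ⟨η, hηpos, ?_⟩
  intro ε hε hε1 a M κ₀ hκ₀ κ κpos hκM hstep m hm1 hmM
  have εpos := hε.pos
  -- `εₙ^σ ≤ t` for `n ≥ 1`
  have hεσ : ∀ n, 1 ≤ n → ε n ^ σ ≤ t := by
    intro n hn
    have hle : ε n ≤ ε 1 := by
      induction n with
      | zero => omega
      | succ n ih =>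
        rcases Nat.lt_or_ge n 1 with h | h
        · have : n = 0 := by omega
          subst this; exact le_rfl
        · exact (hε.succ_le n).trans (ih h)
    calc ε n ^ σ ≤ η ^ σ := rpow_le_rpow (εpos n).le (hle.trans hε1) hσ.le
      _ = t := hησ
  -- the model cascade and the ratio to it
  obtain ⟨k, hk⟩ : ∃ k : ℕ → ℝ, ∀ n, k n = modelDiffusivity a ε M κ₀ n := ⟨_, fun _ => rfl⟩
  have kpos : ∀ n, 0 < k n := fun n => by rw [hk]; exact modelDiffusivity_pos hκ₀ n
  obtain ⟨R, hR⟩ : ∃ R : ℕ → ℝ, ∀ n, R n = max (κ n / k n) (k n / κ n) := ⟨_, fun _ => rfl⟩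
  have hR1 : ∀ n, 1 ≤ R n := by
    intro n; rw [hR]
    rcases le_or_gt (k n) (κ n) with h | h
    · exact le_max_of_le_left ((one_le_div (kpos n)).mpr h)
    · exact le_max_of_le_right ((one_le_div (κpos n)).mpr h.le)
  have hR0 : ∀ n, 0 ≤ R n := fun n => zero_le_one.trans (hR1 n)
  have hRM : R M = 1 := by
    rw [hR, hk, modelDiffusivity_top, hκM, div_self hκ₀.ne', max_self]
  -- from `R ≤ 2` to the inductive range (3.56)
  have hrange : ∀ n, R n ≤ 2 → k n / 2 ≤ κ n ∧ κ n ≤ 2 * k n := by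
    intro n h
    rw [hR] at h
    have h1 : κ n / k n ≤ 2 := (le_max_left _ _).trans h
    have h2 : k n / κ n ≤ 2 := (le_max_right _ _).trans h
    rw [div_le_iff₀ (kpos n)] at h1
    rw [div_le_iff₀ (κpos n)] at h2
    constructor <;> linarith
  -- the one-step ratio bound: `Rₙ ≤ exp(K εₙ^σ) Rₙ₊₁` while `Rₙ₊₁ ≤ 2`
  have hone : ∀ n, 1 ≤ n → n + 1 ≤ M → R (n + 1) ≤ 2 → R n ≤ exp (K * ε n ^ σ) * R (n + 1) := by
    intro n hn1 hn hRn
    obtain ⟨hlo, hhi⟩ := hrange (n + 1) hRn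
    rw [hk] at hlo hhi
    have hst := hstep n hn1 hn hlo hhi
    set E := enhanceStep (a (n + 1)) (ε (n + 1)) (κ (n + 1)) with hEdef
    set E' := enhanceStep (a (n + 1)) (ε (n + 1)) (k (n + 1)) with hE'def
    have hEpos : 0 < E := enhanceStep_pos (κpos _)
    have hE'pos : 0 < E' := enhanceStep_pos (kpos _)
    have hkn : k n = E' := by rw [hE'def, hk, hk]; exact modelDiffusivity_succ hn
    have hθ0 : 0 ≤ C₀ * ε n ^ σ := mul_nonneg hC₀ (rpow_pos_of_pos (εpos n) _).le
    have hθ : C₀ * ε n ^ σ ≤ 1 / 2 := by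
      have h1 := hεσ n hn1
      have h2 : C₀ * t ≤ 1 / 2 := by
        calc C₀ * t ≤ C₀ * (1 / (2 * C₀ + 2)) := mul_le_mul_of_nonneg_left ht1 hC₀
          _ ≤ 1 / 2 := by
              rw [mul_one_div, div_le_div_iff₀ (by positivity) (by norm_num)]; nlinarith
      exact (mul_le_mul_of_nonneg_left h1 hC₀).trans h2
    -- `max{κₙ/E, E/κₙ} ≤ exp(2 C₀ εₙ^σ)` and `max{E/E', E'/E} ≤ Rₙ₊₁`
    have hA := max_div_le_exp_of_abs_sub_le hEpos hθ0 hθ hst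
    have hB : max (E / E') (E' / E) ≤ R (n + 1) := by
      rw [hR]; exact enhanceStep_ratio_le (κpos _) (kpos _)
    have hexp0 : 0 ≤ exp (2 * (C₀ * ε n ^ σ)) := (exp_pos _).le
    -- `κₙ/κ'ₙ = (κₙ/E)(E/E')` and `κ'ₙ/κₙ = (E/κₙ)(E'/E)`
    rw [hR n, hkn]
    have hKe : exp (K * ε n ^ σ) = exp (2 * (C₀ * ε n ^ σ)) := by rw [hK]; ring_nf
    rw [hKe]
    refine max_le ?_ ?_
    · calc κ n / E' = κ n / E * (E / E') := by field_simp
        _ ≤ exp (2 * (C₀ * ε n ^ σ)) * R (n + 1) :=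
            mul_le_mul ((le_max_left _ _).trans hA) ((le_max_left _ _).trans hB)
              (div_pos hEpos hE'pos).le hexp0
    · calc E' / κ n = E / κ n * (E' / E) := by field_simp
        _ ≤ exp (2 * (C₀ * ε n ^ σ)) * R (n + 1) :=
            mul_le_mul ((le_max_right _ _).trans hA) ((le_max_right _ _).trans hB)
              (div_pos hE'pos hEpos).le hexp0
  -- the cascade (3.58) with barrier `B = 2`
  have hdec : ∀ n, ε (n + 1) ^ σ ≤ ρ * ε n ^ σ := fun n => by
    rw [hρ, ← mul_rpow (by positivity) (εpos n).le]
    exact rpow_le_rpow (εpos _).le (hε.succ_le_mul n) hσ.le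
  have hB : R M * exp (K / (1 - ρ) * ε 1 ^ σ) ≤ 2 := by
    rw [hRM, one_mul]
    have h1 : K / (1 - ρ) * ε 1 ^ σ ≤ log 2 := by
      rcases Nat.lt_or_ge M 1 with hM | hM
      · omega
      have := hεσ 1 le_rfl
      calc K / (1 - ρ) * ε 1 ^ σ ≤ K / (1 - ρ) * t :=
            mul_le_mul_of_nonneg_left this (div_nonneg hK0 h1ρ.le)
        _ ≤ K / (1 - ρ) * ((1 - ρ) * log 2 / (K + 1)) :=
            mul_le_mul_of_nonneg_left ht2 (div_nonneg hK0 h1ρ.le)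
        _ = K / (K + 1) * log 2 := by field_simp
        _ ≤ 1 * log 2 := by
            apply mul_le_mul_of_nonneg_right _ hlog2.le
            rw [div_le_one (by linarith)]; linarith
        _ = log 2 := one_mul _
    calc exp (K / (1 - ρ) * ε 1 ^ σ) ≤ exp (log 2) := exp_le_exp.mpr h1
      _ = 2 := exp_log two_pos
  have hcas := cascade_bound_of_le (L := R) (e := fun n => ε n ^ σ) (N := M) (B := 2) hK0 hρ1
    hR0 (fun n => (rpow_pos_of_pos (εpos n) _).le) hdec hB hone m hm1 hmM
  -- conclude: `R m ≤ 2`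
  have hRm : R m ≤ 2 := by
    refine hcas.trans (le_trans ?_ hB)
    refine mul_le_mul_of_nonneg_left (exp_le_exp.mpr ?_) (hR0 M)
    refine mul_le_mul_of_nonneg_left ?_ (div_nonneg hK0 h1ρ.le)
    have hle : ε m ≤ ε 1 := by
      clear hcas hmM
      induction m with
      | zero => omega
      | succ n ih =>
        rcases Nat.lt_or_ge n 1 with h | h
        · have : n = 0 := by omega
          subst this; exact le_rfl
        · exact (hε.succ_le n).trans (ih h)
    exact rpow_le_rpow (εpos m).le hle hσ.le
  have := hrange m hRm
  rw [hk] at this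
  exact this

/-- **Lemma 3.4 ((3.45) p. 43) for perturbed cascades.** Combining Step 1
(`modelDiffusivity_bounds`) and Step 2 (`perturbedDiffusivity_close`): for `β > 0`, `q > 1`,
`γ = (q-1)β/(q+1)`, amplitudes `aₘ = εₘ^{β-2}` and a relative one-step error `C₀ εₙ^σ` as in
(3.57), there are `0 < c ≤ C` (depending only on `β`, `q`) and `η > 0` (depending only on `C₀`,
`σ`) such that every positive sequence `κₘ` started in the permissible window (3.44) at the
critical scale `M` and obeying the step estimate on the inductive range satisfies
`c aₘ εₘ^{2+γ} ≤ κₘ ≤ C aₘ εₘ^{2+γ}` for all `1 ≤ m ≤ M - 1`, for every scale sequence with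
`ε₁ ≤ η`. (The paper's `κₘ = K̄ₘ^{κₘ}` is the case supplied by Lemma 3.3; printed range
`{0, …, M-1}`, see the module docstring of `RenormalizedDiffusivityCascade.lean` on `m = 0`.)
[cite: ArmstrongVicol2025, Lemma 3.4 (3.45) p. 43, proof pp. 44–45] -/
theorem perturbedDiffusivity_bounds {β q σ C₀ : ℝ} (hβ : 0 < β) (hq : 1 < q) (hσ : 0 < σ)
    (hC₀ : 0 ≤ C₀) :
    ∃ c C η : ℝ, 0 < c ∧ c ≤ C ∧ 0 < η ∧
      ∀ ε : ℕ → ℝ, IsScaleSequence q ε → ε 1 ≤ η → ∀ (M : ℕ) (κ₀ : ℝ),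
        ε M ^ (2 * β / (q + 1)) / 2 ≤ κ₀ → κ₀ ≤ 2 * ε M ^ (2 * β / (q + 1)) →
      ∀ κ : ℕ → ℝ, (∀ n, 0 < κ n) → κ M = κ₀ →
        (∀ n, 1 ≤ n → n + 1 ≤ M →
          modelDiffusivity (fun j => ε j ^ (β - 2)) ε M κ₀ (n + 1) / 2 ≤ κ (n + 1) →
          κ (n + 1) ≤ 2 * modelDiffusivity (fun j => ε j ^ (β - 2)) ε M κ₀ (n + 1) →
          |κ n - enhanceStep (ε (n + 1) ^ (β - 2)) (ε (n + 1)) (κ (n + 1))| ≤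
            C₀ * ε n ^ σ * enhanceStep (ε (n + 1) ^ (β - 2)) (ε (n + 1)) (κ (n + 1))) →
        ∀ m : ℕ, 1 ≤ m → m < M →
          c * (ε m ^ (β - 2) * ε m ^ (2 + gammaExp β q)) ≤ κ m ∧
            κ m ≤ C * (ε m ^ (β - 2) * ε m ^ (2 + gammaExp β q)) := by
  obtain ⟨c, C, hc, hcC, h1⟩ := modelDiffusivity_bounds hβ hq
  obtain ⟨η, hη, h2⟩ := perturbedDiffusivity_close (q := q) hσ hC₀
  refine ⟨c / 2, 2 * C, η, by positivity, by linarith, hη, ?_⟩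
  intro ε hε hε1 M κ₀ hκ1 hκ2 κ κpos hκM hstep m hm1 hmM
  have hκ₀ : 0 < κ₀ := lt_of_lt_of_le (by have := hε.pos M; positivity) hκ1
  obtain ⟨hlo, hhi⟩ := h1 ε hε M κ₀ hκ1 hκ2 m hm1 hmM
  obtain ⟨hlo', hhi'⟩ :=
    h2 ε hε hε1 (fun j => ε j ^ (β - 2)) M κ₀ hκ₀ κ κpos hκM hstep m hm1 hmM.le
  have hP : 0 ≤ ε m ^ (β - 2) * ε m ^ (2 + gammaExp β q) := by
    have := hε.pos m; positivity
  constructor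
  · calc c / 2 * (ε m ^ (β - 2) * ε m ^ (2 + gammaExp β q))
          = c * (ε m ^ (β - 2) * ε m ^ (2 + gammaExp β q)) / 2 := by ring
      _ ≤ modelDiffusivity (fun j => ε j ^ (β - 2)) ε M κ₀ m / 2 := by linarith
      _ ≤ κ m := hlo'
  · calc κ m ≤ 2 * modelDiffusivity (fun j => ε j ^ (β - 2)) ε M κ₀ m := hhi'
      _ ≤ 2 * (C * (ε m ^ (β - 2) * ε m ^ (2 + gammaExp β q))) := by linarith
      _ = 2 * C * (ε m ^ (β - 2) * ε m ^ (2 + gammaExp β q)) := by ring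

end ArmstrongVicol2025

end Literature.Analysis.FluidPDE
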